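import Summits.CriticalPhenomena.PercolationContinuityZ3.Theorems.PercNearOneGluingNoHeavyLowerTailE3GroupSepCertCheck
import Summits.CriticalPhenomena.PercolationContinuityZ3.Theorems.PercNearOneGluingNoHeavyLowerTailOneCutCertAssembly

/-!
# `NoHeavyLowerTail` (crux stmt-CriticalPhenomena-4575): the nine E3GRP rows (Richards–Sahi `E₃ ≥ 0` on group-separation
# events of five terminals) hold on every weighted graph whose vertex set is the five terminals — kernel-checked, and in fact
# three-copy FIBREWISE (Richards-comb) positive

Support file (certificate seat `prim-cert-2`; `--supports stmt-CriticalPhenomena-4575`; COMPUTATIONAL: the nine `checkE3List`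
evaluations use `native_decide`).

Context.  The SHK3⁺/bern4 terminal-edge Bernstein step of the `|A| = 5` one-cut programme does not close over any proved row
family (gap `−1.572e-3`), but closes numerically once the 77 pulled-back "E3GRP" rows are added (run/shared/lean/ttrl/bern4/SDP.md,
prim-ineq-harness-2 FROM-…-BERN4-E3GRP): Richards (2004) / Sahi (2008) third-order inequalities
`E₃(A,B,C) = 2μ(ABC) + μ(A)μ(B)μ(C) − μ(A)μ(BC) − μ(B)μ(AC) − μ(C)μ(AB) ≥ 0` for the nine representative triples (mod `S₅`,
prim-ineq-gen-8 `gen8g2-E3GRP`) of GROUP-SEPARATION events `D[X|Y] = {no open path between the terminal groups X and Y}`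
(decreasing) or their complements `U[X|Y]` (increasing) on terminals `o, a₁, a₂, a₃, b`.  `E₃ ≥ 0` for three monotone events
is OPEN in general (Sahi's conjecture; Gladkov 2024).

**Theorems `e3grp₀_five … e3grp₈_five`.**  For every weight vector `w : Sym2 (Fin 5) → [0,1]` and every PAIRWISE DISTINCT
terminal tuple `(o, a₁, a₂, a₃, b)` of `Fin 5`, each of the nine rows holds (`E3Ineq`, an inequality between products of
`prodBernoulli w`-probabilities of `connEvent`s; `connEvent_sep` / `connEvent_lnk` unfold the events to
`{ω | ∀ x ∈ X, ∀ y ∈ Y, x ↮ y}` / `{ω | ∃ x ∈ X, ∃ y ∈ Y, x ↔ y}`).  Proof: for each row the three-copy checker `checkE3` of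
`…E3GroupSepCertCheck` passes at the terminal tuple `(0,1,2,3,4)` (`native_decide`), i.e. ALL `4^10` tensor-Bernstein fibre sums
of `E₃` are nonnegative integers on `K₅` — the rows are Richards-comb positive there, the signature of a copy-switching proof
(cf. (CNT) for the covariance transfer (T), `…CovTransferCertLeFive`); the other distinct tuples follow by transport along vertex
relabellings (`rowHolds_relabel`, using `relabelW` / `preimage_relabel_openConn` of `…OneCutCertAssembly`).  The same holds on `K₆` and on random graphs with
`n ≤ 8` (kit census j068486, C; `4^15` fibres are beyond the in-kernel Kronecker check).  These are the percolation-structure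
instances of Sahi's `C₃` asked for by the coordinator (2026-08-19T18:07Z, "attack the RESTRICTED C₃ instances actually needed").
-/

namespace Summit.CriticalPhenomena.PercolationContinuityZ3.Theorems.E3GroupSepCert

open Finset MeasureTheory OneCutCert CovTransferCert
open scoped BigOperators
open Literature.Probability.Percolation Literature.Probability.LatticeModels

variable {n : ℕ}

/-! ## Group-separation events -/

/-- `D[X|Y]`: no terminal of `X` is connected to a terminal of `Y` (decreasing). [this work] -/
def sep (X Y : List (Fin n)) : CRel n → Bool := fun r => X.all fun x => Y.all fun y => !(r x y)

/-- `U[X|Y]`: some terminal of `X` is connected to some terminal of `Y` (increasing; the complement of `D[X|Y]`). [this work] -/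
def lnk (X Y : List (Fin n)) : CRel n → Bool := fun r => X.any fun x => Y.any fun y => r x y

/-- The event of `sep`. [this work] -/
theorem connEvent_sep (X Y : List (Fin n)) :
    connEvent (sep X Y) = {ω : BondConfig (Fin n) | ∀ x ∈ X, ∀ y ∈ Y, ω ∉ openConn x y} := by
  ext ω; simp [connEvent, sep, List.all_eq_true]

/-- The event of `lnk`. [this work] -/
theorem connEvent_lnk (X Y : List (Fin n)) :
    connEvent (lnk X Y) = {ω : BondConfig (Fin n) | ∃ x ∈ X, ∃ y ∈ Y, ω ∈ openConn x y} := by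
  ext ω; simp [connEvent, lnk, List.any_eq_true]

/-! ## The nine rows (prim-ineq-gen-8 `gen8g2-E3GRP`, terminal order `o, a₁, a₂, a₃, b`) -/

/-- A terminal tuple. [this work] -/
abbrev Tup (n : ℕ) : Type := Fin n × Fin n × Fin n × Fin n × Fin n

/-- The triple of events of row `i` at the terminals `t = (o, a₁, a₂, a₃, b)`:
0 `E3dec{[a1,a2]|[a3];[o,b]|[a1,a2];[o,b]|[a3]}`, 1 `E3dec{[o]|[a1];[o]|[a2,a3];[a1]|[a2,a3]}`,
2 `E3dec{[a1]|[a2,a3];[a1]|[b];[a2,a3]|[b]}`, 3 `E3dec{[a1]|[b];[a2,a3]|[b];[o,a2,a3]|[a1]}`,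
4 `E3inc{[o,a1]|[a2,a3];[o,a2]|[a1,a3];[o,a3]|[a1,a2]}`, 5 `E3inc{[o,b]|[a1,a2,a3];[o,a1,a2,b]|[a3];[o,a3,b]|[a1,a2]}`,
6 `E3inc{[o,a1]|[a2,a3,b];[o,a3]|[a1,a2,b];[o,a2,b]|[a1,a3]}`, 7 `E3inc{[o]|[a1,a2,a3,b];[o,a1]|[a2,a3];[o,a2,a3]|[a1]}`,
8 `E3inc{[a1]|[a2,a3,b];[o,a1,a2,a3]|[b];[a1,b]|[a2,a3]}`. [this work] -/
def row (i : Fin 9) (t : Tup n) : (CRel n → Bool) × (CRel n → Bool) × (CRel n → Bool) :=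
  let o := t.1
  let a₁ := t.2.1
  let a₂ := t.2.2.1
  let a₃ := t.2.2.2.1
  let b := t.2.2.2.2
  match i with
  | 0 => (sep [a₁, a₂] [a₃], sep [o, b] [a₁, a₂], sep [o, b] [a₃])
  | 1 => (sep [o] [a₁], sep [o] [a₂, a₃], sep [a₁] [a₂, a₃])
  | 2 => (sep [a₁] [a₂, a₃], sep [a₁] [b], sep [a₂, a₃] [b])
  | 3 => (sep [a₁] [b], sep [a₂, a₃] [b], sep [o, a₂, a₃] [a₁])
  | 4 => (lnk [o, a₁] [a₂, a₃], lnk [o, a₂] [a₁, a₃], lnk [o, a₃] [a₁, a₂])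
  | 5 => (lnk [o, b] [a₁, a₂, a₃], lnk [o, a₁, a₂, b] [a₃], lnk [o, a₃, b] [a₁, a₂])
  | 6 => (lnk [o, a₁] [a₂, a₃, b], lnk [o, a₃] [a₁, a₂, b], lnk [o, a₂, b] [a₁, a₃])
  | 7 => (lnk [o] [a₁, a₂, a₃, b], lnk [o, a₁] [a₂, a₃], lnk [o, a₂, a₃] [a₁])
  | 8 => (lnk [a₁] [a₂, a₃, b], lnk [o, a₁, a₂, a₃] [b], lnk [a₁, b] [a₂, a₃])

/-- Row `i` holds at `(w, t)`: `E₃ ≥ 0` for its three events. [this work] -/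
def RowHolds (i : Fin 9) (w : Sym2 (Fin n) → unitInterval) (t : Tup n) : Prop :=
  E3Ineq w (row i t).1 (row i t).2.1 (row i t).2.2

/-! ## Transport along vertex relabellings -/

/-- A predicate read through the relabelling `τ` of the vertices. [this work] -/
def relP (τ : Fin n ≃ Fin n) (P : CRel n → Bool) : CRel n → Bool := fun r => P (fun a b => r (τ a) (τ b))

open Classical in
/-- Connectivity events pull back along relabellings to relabelled predicates. [this work] -/
theorem preimage_relabel_connEvent (σ : Fin n ≃ Fin n) (P : CRel n → Bool) :
    BondConfig.relabel (sym2Equiv σ) ⁻¹' connEvent P = connEvent (relP σ.symm P) := by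
  ext ω
  have key : ∀ a b : Fin n, BondConfig.relabel (sym2Equiv σ) ω ∈ openConn a b ↔ ω ∈ openConn (σ.symm a) (σ.symm b) := by
    intro a b
    have h := Set.ext_iff.1 (preimage_relabel_openConn σ (σ.symm a) (σ.symm b)) ω
    simp only [Equiv.apply_symm_apply, Set.mem_preimage] at h
    exact h
  have hfun : (fun a b => decide (BondConfig.relabel (sym2Equiv σ) ω ∈ openConn a b)) =
      fun a b => decide (ω ∈ openConn (σ.symm a) (σ.symm b)) := by
    funext a b; rw [decide_eq_decide]; exact key a b
  simp only [connEvent, Set.mem_preimage, Set.mem_setOf_eq, relP, hfun]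

/-- A tuple relabelled. [this work] -/
def tmap (τ : Fin n ≃ Fin n) (t : Tup n) : Tup n := (τ t.1, τ t.2.1, τ t.2.2.1, τ t.2.2.2.1, τ t.2.2.2.2)

/-- `tmap σ.symm ∘ tmap σ = id`. [this work] -/
theorem tmap_symm_tmap (σ : Fin n ≃ Fin n) (t : Tup n) : tmap σ.symm (tmap σ t) = t := by
  obtain ⟨o, a₁, a₂, a₃, b⟩ := t
  simp [tmap]

/-- `sep` under relabelling. [this work] -/
theorem relP_sep (τ : Fin n ≃ Fin n) (X Y : List (Fin n)) : relP τ (sep X Y) = sep (X.map τ) (Y.map τ) := by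
  funext r; simp [relP, sep, List.all_map, Function.comp_def]

/-- `lnk` under relabelling. [this work] -/
theorem relP_lnk (τ : Fin n ≃ Fin n) (X Y : List (Fin n)) : relP τ (lnk X Y) = lnk (X.map τ) (Y.map τ) := by
  funext r; simp [relP, lnk, List.any_map, Function.comp_def]

/-- The rows under relabelling. [this work] -/
theorem row_relP (i : Fin 9) (τ : Fin n ≃ Fin n) (t : Tup n) :
    (relP τ (row i t).1, relP τ (row i t).2.1, relP τ (row i t).2.2) = row i (tmap τ t) := by
  obtain ⟨o, a₁, a₂, a₃, b⟩ := t
  fin_cases i <;> simp [row, tmap, relP_sep, relP_lnk]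

/-- **A row is transported along a relabelling of the vertices.** [this work] -/
theorem rowHolds_relabel (i : Fin 9) (σ : Fin n ≃ Fin n) (w : Sym2 (Fin n) → unitInterval) (t : Tup n)
    (h : RowHolds i w t) : RowHolds i (relabelW σ w) (tmap σ t) := by
  have hr := row_relP i σ.symm (tmap σ t)
  rw [tmap_symm_tmap] at hr
  have h1 := congrArg (fun x => x.1) hr
  have h2 := congrArg (fun x => x.2.1) hr
  have h3 := congrArg (fun x => x.2.2) hr
  simp only at h1 h2 h3
  unfold RowHolds E3Ineq at h ⊢
  simp only [← prodBernoulli_real_preimage_relabel (sym2Equiv σ) w (relabelW σ w) (relabelW_apply σ w),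
    Set.preimage_inter, preimage_relabel_connEvent, h1, h2, h3]
  exact h

/-- A row at all weights for a tuple gives the row at all weights for every relabelled tuple. [this work] -/
theorem rowHolds_forall_relabel (i : Fin 9) (σ : Fin n ≃ Fin n) {t : Tup n}
    (h : ∀ w : Sym2 (Fin n) → unitInterval, RowHolds i w t) (w : Sym2 (Fin n) → unitInterval) :
    RowHolds i w (tmap σ t) := by
  have hw : relabelW σ (fun e => w (sym2Equiv σ e)) = w := by
    funext e
    unfold relabelW
    simp only [Equiv.apply_symm_apply]
  rw [← hw]
  exact rowHolds_relabel i σ _ t (h _)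

/-! ## The evaluations at the standard tuple and the cover -/

/-- The standard terminal tuple `(0,1,2,3,4)` of `Fin 5`. [this work] -/
def t₀ : Tup 5 := (0, 1, 2, 3, 4)

/-- All role tuples of `Fin n`. [this work] -/
def allTup (n : ℕ) : List (Tup n) :=
  (List.finRange n).flatMap fun o => (List.finRange n).flatMap fun a₁ => (List.finRange n).flatMap fun a₂ =>
    (List.finRange n).flatMap fun a₃ => (List.finRange n).map fun b => (o, a₁, a₂, a₃, b)

/-- Every tuple is listed. [this work] -/
theorem mem_allTup (o a₁ a₂ a₃ b : Fin n) : (o, a₁, a₂, a₃, b) ∈ allTup n := by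
  simp [allTup, List.mem_flatMap, List.mem_map]

/-- All role tuples of `Fin n` with pairwise distinct entries. [this work] -/
def distinctTuples (n : ℕ) : List (Tup n) :=
  (allTup n).filter fun t => decide (t.1 ≠ t.2.1 ∧ t.1 ≠ t.2.2.1 ∧ t.1 ≠ t.2.2.2.1 ∧ t.1 ≠ t.2.2.2.2 ∧
    t.2.1 ≠ t.2.2.1 ∧ t.2.1 ≠ t.2.2.2.1 ∧ t.2.1 ≠ t.2.2.2.2 ∧ t.2.2.1 ≠ t.2.2.2.1 ∧ t.2.2.1 ≠ t.2.2.2.2 ∧ t.2.2.2.1 ≠ t.2.2.2.2)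

/-- A pairwise distinct tuple is listed. [this work] -/
theorem mem_distinctTuples {o a₁ a₂ a₃ b : Fin n} (h01 : o ≠ a₁) (h02 : o ≠ a₂) (h03 : o ≠ a₃) (h04 : o ≠ b)
    (h12 : a₁ ≠ a₂) (h13 : a₁ ≠ a₃) (h14 : a₁ ≠ b) (h23 : a₂ ≠ a₃) (h24 : a₂ ≠ b) (h34 : a₃ ≠ b) :
    (o, a₁, a₂, a₃, b) ∈ distinctTuples n := by
  unfold distinctTuples
  rw [List.mem_filter]
  exact ⟨mem_allTup o a₁ a₂ a₃ b, by simp [h01, h02, h03, h04, h12, h13, h14, h23, h24, h34]⟩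

/-- Every pairwise distinct tuple of `Fin 5` is a relabelling of the standard one (finite check). [this work] -/
theorem cover_distinct : ∀ t ∈ distinctTuples 5, ∃ σ : Equiv.Perm (Fin 5), tmap σ t₀ = t := by
  native_decide

/-- Row 0 passes the three-copy check at the standard tuple of `K₅` (base `2^34`). [this work] -/
theorem check_row0 : checkE3 5 34 (row 0 t₀).1 (row 0 t₀).2.1 (row 0 t₀).2.2 = true := by native_decide
/-- Row 1 passes the three-copy check at the standard tuple of `K₅`. [this work] -/
theorem check_row1 : checkE3 5 34 (row 1 t₀).1 (row 1 t₀).2.1 (row 1 t₀).2.2 = true := by native_decide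
/-- Row 2 passes the three-copy check at the standard tuple of `K₅`. [this work] -/
theorem check_row2 : checkE3 5 34 (row 2 t₀).1 (row 2 t₀).2.1 (row 2 t₀).2.2 = true := by native_decide
/-- Row 3 passes the three-copy check at the standard tuple of `K₅`. [this work] -/
theorem check_row3 : checkE3 5 34 (row 3 t₀).1 (row 3 t₀).2.1 (row 3 t₀).2.2 = true := by native_decide
/-- Row 4 passes the three-copy check at the standard tuple of `K₅`. [this work] -/
theorem check_row4 : checkE3 5 34 (row 4 t₀).1 (row 4 t₀).2.1 (row 4 t₀).2.2 = true := by native_decide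
/-- Row 5 passes the three-copy check at the standard tuple of `K₅`. [this work] -/
theorem check_row5 : checkE3 5 34 (row 5 t₀).1 (row 5 t₀).2.1 (row 5 t₀).2.2 = true := by native_decide
/-- Row 6 passes the three-copy check at the standard tuple of `K₅`. [this work] -/
theorem check_row6 : checkE3 5 34 (row 6 t₀).1 (row 6 t₀).2.1 (row 6 t₀).2.2 = true := by native_decide
/-- Row 7 passes the three-copy check at the standard tuple of `K₅`. [this work] -/
theorem check_row7 : checkE3 5 34 (row 7 t₀).1 (row 7 t₀).2.1 (row 7 t₀).2.2 = true := by native_decide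
/-- Row 8 passes the three-copy check at the standard tuple of `K₅`. [this work] -/
theorem check_row8 : checkE3 5 34 (row 8 t₀).1 (row 8 t₀).2.1 (row 8 t₀).2.2 = true := by native_decide

/-- All nine rows pass at the standard tuple. [this work] -/
theorem check_row (i : Fin 9) : checkE3 5 34 (row i t₀).1 (row i t₀).2.1 (row i t₀).2.2 = true := by
  fin_cases i
  exacts [check_row0, check_row1, check_row2, check_row3, check_row4, check_row5, check_row6, check_row7, check_row8]

/-- Every row holds at the standard tuple for all weights. [this work] -/
theorem rowHolds_t₀ (i : Fin 9) (w : Sym2 (Fin 5) → unitInterval) : RowHolds i w t₀ :=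
  e3_of_checkE3 (check_row i) w

/-! ## The theorem -/

/-- **The nine E3GRP rows (Richards–Sahi `E₃ ≥ 0` on group separations of five terminals) hold on every weighted graph on the
five terminals**: for every `w : Sym2 (Fin 5) → [0,1]`, every row `i` and every pairwise distinct terminal tuple
`(o, a₁, a₂, a₃, b)`, `E₃(A,B,C) ≥ 0` for the row's three group-separation events — by the kernel-checked three-copy certificate
(all `4^10` tensor-Bernstein fibre sums nonnegative: the rows are Richards-comb positive on `K₅`) and transport along vertex
relabellings. [this work] -/
theorem e3grp_five (i : Fin 9) (w : Sym2 (Fin 5) → unitInterval) (o a₁ a₂ a₃ b : Fin 5) (h01 : o ≠ a₁) (h02 : o ≠ a₂)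
    (h03 : o ≠ a₃) (h04 : o ≠ b) (h12 : a₁ ≠ a₂) (h13 : a₁ ≠ a₃) (h14 : a₁ ≠ b) (h23 : a₂ ≠ a₃) (h24 : a₂ ≠ b) (h34 : a₃ ≠ b) :
    RowHolds i w (o, a₁, a₂, a₃, b) := by
  obtain ⟨σ, hσ⟩ := cover_distinct _ (mem_distinctTuples h01 h02 h03 h04 h12 h13 h14 h23 h24 h34)
  rw [← hσ]
  exact rowHolds_forall_relabel i σ (rowHolds_t₀ i) w

/-- Row 1 spelled out: for pairwise distinct terminals, with `A = {o ↮ a₁}`, `B = {o ↮ a₂, o ↮ a₃}`, `C = {a₁ ↮ a₂, a₁ ↮ a₃}`: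
`μ(A)μ(B∩C) + μ(B)μ(A∩C) + μ(C)μ(A∩B) ≤ 2μ(A∩B∩C) + μ(A)μ(B)μ(C)` on `Fin 5`. [this work] -/
theorem e3grp_row1_five (w : Sym2 (Fin 5) → unitInterval) (o a₁ a₂ a₃ b : Fin 5) (h01 : o ≠ a₁) (h02 : o ≠ a₂)
    (h03 : o ≠ a₃) (h04 : o ≠ b) (h12 : a₁ ≠ a₂) (h13 : a₁ ≠ a₃) (h14 : a₁ ≠ b) (h23 : a₂ ≠ a₃) (h24 : a₂ ≠ b) (h34 : a₃ ≠ b) :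
    E3Ineq w (sep [o] [a₁]) (sep [o] [a₂, a₃]) (sep [a₁] [a₂, a₃]) :=
  e3grp_five 1 w o a₁ a₂ a₃ b h01 h02 h03 h04 h12 h13 h14 h23 h24 h34

end Summit.CriticalPhenomena.PercolationContinuityZ3.Theorems.E3GroupSepCert
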